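import Mathlib
import Literature.Geometry.Lorentzian.KerrConvergence
import Literature.Geometry.Lorentzian.KerrSchild
import HarnessLib

/-!
# OrientationAnchor

Topic `Literature/Uncategorized`. The "orientation anchor" predicate of the crux `NeckGapDecay`
(route StarvedNecks of `FinalStateConjecture`), verbatim the definition of the line skeleton `Lines/Sketch.lean`,
given a Literature-level name so that the registered stubs `OrientationAnchorHolds` / `NoLateEscape` /
`GapConeCertificateHolds` can be stated over Literature-level names only (the gate relocates those closed
statements next to this file, cf. `Literature.Uncategorized.HonestCore`, `Literature.Uncategorized.LateEscape`).

* `Literature.Uncategorized.OrientationAnchor`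
-/

namespace Literature.Uncategorized

open scoped Manifold ContDiff Topology ENNReal
open Filter Set MeasureTheory Topology Literature.Geometry.Lorentzian

/-- **Orientation anchor** of the input hole charts of a final-state decomposition `d` of `O` beyond radius
`R₀`: for every hole `i` and radius `R` there is a chart time `T` after which, on the shell
`{T ≤ tᵢ, R₀ ≤ rᵢ ≤ R}` of the boosted Kerr domain, the push-forward `dΨᵢ(Λᵢe₀)` of the label's time axis
under the INPUT hole chart `Ψᵢ = d.chart i` is future-directed.  A predicate (not a claim); it is the conclusion
of the registered stub `OrientationAnchorHolds` (S2) of the line skeleton of the crux `StarvedNecks.NeckGapDecay`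
and a hypothesis of its stubs `NoLateEscape` (S4b) and `GapConeCertificateHolds` (P). [folklore] -/
def OrientationAnchor (𝓢 : Spacetime.{0} 4) (O : Set 𝓢.carrier) (k : ℕ) (d : FinalStateDecomposition 𝓢 O k)
    (R₀ : ℝ) : Prop :=
  ∀ (i : Fin d.N) (R : ℝ), ∃ T : ℝ, ∀ x : (d.background i).domain,
    T ≤ (d.background i).time x.1 → R₀ ≤ (d.background i).radius x.1 → (d.background i).radius x.1 ≤ R →
      𝓢.timeOrientation.IsFutureDirected
        (mfderiv 𝓘(ℝ, E4) (𝓡 4) (d.chart i) x (((d.motion i).1 : E4 ≃L[ℝ] E4) (E4.basisVector 0)))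

end Literature.Uncategorized
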